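import Mathlib.CategoryTheory.Limits.Shapes.ConcreteCategory
import Mathlib.CategoryTheory.Functor.OfSequence
import Literature.AlgebraicGeometry.Motives.ProetAffineCovers
import Literature.AlgebraicGeometry.Motives.ProetAffineAlgebra
import Literature.RingTheory.Etale.WeaklyEtaleDirectLimit
import HarnessLib

/-!
# Countable products of epimorphisms in `Shv(X_proét)` are epimorphisms

Bhatt–Scholze, *The pro-étale topology for schemes*, Prop. 3.1.9: "Countable products are exact in
a replete topos", applied to `Shv(X_proét)` (replete by Prop. 4.2.8). On Mathlib's small pro-étale
site `X.ProEt` (all weakly étale `X`-schemes, fpqc covers; no cardinality cut-off) we prove the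
statement directly by the tower argument of Example 3.1.7, without w-contractible objects:

* `piSheaf_sections_bijective` — sections of a product of abelian sheaves are families of
  sections;
* `stage φ U s` — for epimorphisms `φ_m : F_m → G_m`, an affine `U` and sections `s_m ∈ G_m(U)`,
  **the tower `U = V₀ ← V₁ ← ⋯` of affine surjective covers in `X_proét`** with `s_m` lifting to
  `F_m` over `V_{m+1}` (`liftingCover` at each step); `stageHom`, `stageAlgHom`: its transition
  maps and the directed system of `Γ(U)`-algebras `Γ(V_m)`, each weakly étale and faithfully flat;
* `towerLimit φ U s = colim_m Γ(V_m)`, weakly étale and faithfully flat over `Γ(U)`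
  (`Literature.RingTheory.Etale.weaklyEtale_directLimit`, Lemma 4.1.8), and
  `towerSpec = Spec (colim Γ(V_m)) → U`, **a single pro-étale cover over which every `s_m` lifts**
  (`exists_lift_towerSpec`);
* `epi_piMap_of_epi` — **`∏_m φ_m : ∏ F_m → ∏ G_m` is an epimorphism** (local surjectivity over
  the affine opens, `ofArrows_affineOpens_mem_proEtTopology`).

## References

* B. Bhatt, P. Scholze, *The pro-étale topology for schemes*, Astérisque 369 (2015)
  (arXiv:1309.1198): Example 3.1.7, Lemma 3.1.8, Prop. 3.1.9, Def. 4.1.1, Lemma 4.1.8,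
  Prop. 4.2.8. [BhattScholze2015]

## Design notes

* The tower is a structural recursion `stage : ℕ → AffineCoverOver X U` (object, map to `U`,
  affineness, surjectivity); the iterated transition maps are `Functor.OfSequence.map` in
  `(X.ProEt)ᵒᵖ`, which gives the functoriality needed for `DirectedSystem`.
* `towerSpec`/`towerSpecHom` are named (rather than inlined `proetSpec U (towerLimit …)`) to keep
  elaboration of the final lifting argument cheap.
* Mathlib searches: `PreservesProduct.iso`, `Concrete.productEquiv`, `Presheaf.imageSieve`,
  `Sheaf.isLocallySurjective_iff_epi'`, `GrothendieckTopology.transitive`; nothing on exactness of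
  products in categories of sheaves. Nothing restated.
-/

universe u

open CategoryTheory CategoryTheory.Limits Opposite AlgebraicGeometry

noncomputable section

-- `X.ProEt = MorphismProperty.Over @WeaklyEtale ⊤ X` feeds the class `@WeaklyEtale` where a
-- `MorphismProperty` is expected; as in Mathlib's `AlgebraicGeometry/Sites/Proetale.lean`, the
-- unifier must be allowed to unfold it when rewriting in goals mentioning objects of `X.ProEt`.
set_option backward.isDefEq.respectTransparency false

namespace Literature.AlgebraicGeometry.Motives

variable {X : Scheme.{u}}

/-! ### Sections of a product of sheaves -/

section Sections

/-- **Sections of a product of abelian sheaves are families of sections**: for sheaves `G_m` on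
`X_proét`, `s ↦ (pr_m s)_m` is a bijection `(∏ G_m)(U) ≃ ∏_m G_m(U)` (limits of sheaves are
computed sectionwise). [folklore] -/
theorem piSheaf_sections_bijective {ι : Type} (G : ι → Sheaf (Scheme.ProEt.topology X) Ab.{u + 1})
    (U : (X.ProEt)ᵒᵖ) :
    Function.Bijective fun (s : (∏ᶜ G).obj.obj U) (m : ι) => (Pi.π G m).hom.app U s := by
  let Ψ : Sheaf (Scheme.ProEt.topology X) Ab.{u + 1} ⥤ Ab.{u + 1} :=
    sheafToPresheaf _ _ ⋙ (evaluation _ _).obj U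
  let e₁ : Ψ.obj (∏ᶜ G) ≅ ∏ᶜ fun m => Ψ.obj (G m) := PreservesProduct.iso Ψ G
  let e₂ : (forget Ab.{u + 1}).obj (∏ᶜ fun m => Ψ.obj (G m)) ≃ ∀ m, Ψ.obj (G m) :=
    Concrete.productEquiv _
  have key : (fun (s : (∏ᶜ G).obj.obj U) (m : ι) => (Pi.π G m).hom.app U s) =
      e₂ ∘ fun s => e₁.hom s := by
    funext s m
    simp only [Function.comp_apply, e₂, Concrete.productEquiv_apply_apply, e₁]
    rw [← ConcreteCategory.comp_apply, PreservesProduct.iso_hom, piComparison_comp_π]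
    rfl
  rw [key]
  exact e₂.bijective.comp e₁.addCommGroupIsoToAddEquiv.bijective

end Sections

/-! ### The tower of affine covers attached to a sequence of sections -/

section Tower

variable {F G : ℕ → Sheaf (Scheme.ProEt.topology X) Ab.{u + 1}} (φ : ∀ m, F m ⟶ G m)
  [∀ m, Epi (φ m)] (U : X.ProEt) [IsAffine U.left] (s : ∀ m, (G m).obj.obj (op U))

variable (X) in
/-- An affine object of `X_proét` with a surjective map to `U`. [folklore] -/
structure AffineCoverOver (U : X.ProEt) where
  /-- the object -/
  obj : X.ProEt
  /-- its structure map to `U` -/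
  hom : obj ⟶ U
  /-- the object is affine -/
  isAffine : IsAffine obj.left
  /-- the structure map is surjective -/
  surjective : Surjective hom.left

variable {U} in
/-- The object of an affine cover over `U` is affine. [folklore] -/
instance AffineCoverOver.isAffine_obj_left (T : AffineCoverOver X U) : IsAffine T.obj.left :=
  T.isAffine

variable {U} in
/-- The structure map of an affine cover over `U` is surjective. [folklore] -/
instance AffineCoverOver.surjective_hom_left (T : AffineCoverOver X U) : Surjective T.hom.left :=
  T.surjective

/-- **The tower `U = V₀ ← V₁ ← V₂ ← ⋯` of affine surjective covers** attached to epimorphisms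
`φ_m : F_m → G_m` and sections `s_m ∈ G_m(U)` (`U` affine): `V_{m+1} → V_m` is a lifting cover
for `s_m|_{V_m}` along `φ_m` (`liftingCover`), so that `s_m` lifts to `F_m` over `V_n` for all
`n > m`. This is the tower of Bhatt–Scholze Example 3.1.7 ("Inductively, for each `n ≥ 0`, there
exist faithfully flat maps `A → B_n` compatible in `n` and sections … such that `s_n` lifts
`s_{n-1}`"), run in `X_proét`. [cite: BhattScholze2015, Example 3.1.7] -/
def stage : ℕ → AffineCoverOver X U
  | 0 => ⟨U, 𝟙 U, inferInstance, inferInstanceAs (Surjective (𝟙 U.left))⟩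
  | m + 1 =>
    letI := (stage m).isAffine
    let L := liftingCover (φ m) (stage m).obj ((G m).obj.map (stage m).hom.op (s m))
    ⟨L.obj, L.hom ≫ (stage m).hom, L.isAffine, by
      haveI := L.surjective
      haveI := (stage m).surjective
      exact inferInstanceAs (Surjective (L.hom.left ≫ (stage m).hom.left))⟩

/-- The lifting cover `V_{m+1} → V_m` used at step `m`. [folklore] -/
def stageCover (m : ℕ) :
    LiftingCover (φ m) (stage φ U s m).obj ((G m).obj.map (stage φ U s m).hom.op (s m)) :=
  liftingCover (φ m) _ _

/-- `V_{m+1}` is the object of the `m`-th lifting cover (by `rfl`). [folklore] -/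
theorem stage_succ_obj (m : ℕ) : (stage φ U s (m + 1)).obj = (stageCover φ U s m).obj := rfl

/-- The transition map `V_{m+1} ⟶ V_m`. [folklore] -/
def stageStep (m : ℕ) : (stage φ U s (m + 1)).obj ⟶ (stage φ U s m).obj := (stageCover φ U s m).hom

/-- `V_{m+1} → U` is `V_{m+1} → V_m → U` (by `rfl`). [folklore] -/
theorem stage_succ_hom (m : ℕ) :
    (stage φ U s (m + 1)).hom = stageStep φ U s m ≫ (stage φ U s m).hom := rfl

/-- `s_m` lifts to `F_m` over `V_{m+1}`. [folklore] -/
theorem exists_lift_stage_succ (m : ℕ) :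
    ∃ t : (F m).obj.obj (op (stage φ U s (m + 1)).obj),
      (φ m).hom.app _ t = (G m).obj.map (stage φ U s (m + 1)).hom.op (s m) :=
  ⟨(stageCover φ U s m).lift, (stageCover φ U s m).map_lift.trans (by
    rw [← ConcreteCategory.comp_apply, ← Functor.map_comp, ← op_comp]
    rfl)⟩

/-- The iterated transition maps `V_j ⟶ V_i` for `i ≤ j`. [folklore] -/
def stageHom (i j : ℕ) (h : i ≤ j) : (stage φ U s j).obj ⟶ (stage φ U s i).obj :=
  (Functor.OfSequence.map (X := fun m => op (stage φ U s m).obj)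
    (fun m => (stageStep φ U s m).op) i j h).unop

/-- `V_i ⟶ V_i` is the identity. [folklore] -/
@[simp] theorem stageHom_self (i : ℕ) (h : i ≤ i) : stageHom φ U s i i h = 𝟙 _ := by
  rw [stageHom, Functor.OfSequence.map_id]
  rfl

/-- `V_{i+1} ⟶ V_i` is the transition map. [folklore] -/
theorem stageHom_succ (i : ℕ) (h : i ≤ i + 1) : stageHom φ U s i (i + 1) h = stageStep φ U s i := by
  rw [stageHom, Functor.OfSequence.map_le_succ]
  rfl

/-- Transitivity of the iterated transition maps. [folklore] -/
theorem stageHom_trans (i j k : ℕ) (hij : i ≤ j) (hjk : j ≤ k) :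
    stageHom φ U s i k (hij.trans hjk) = stageHom φ U s j k hjk ≫ stageHom φ U s i j hij := by
  rw [stageHom, stageHom, stageHom, ← unop_comp, ← Functor.OfSequence.map_comp]

/-- The iterated transition maps are compatible with the structure maps to `U`. [folklore] -/
theorem stageHom_comp_hom (i j : ℕ) (h : i ≤ j) :
    stageHom φ U s i j h ≫ (stage φ U s i).hom = (stage φ U s j).hom := by
  induction j, h using Nat.le_induction with
  | base => rw [stageHom_self, Category.id_comp]
  | succ j hij ih =>
    rw [stageHom_trans φ U s i j (j + 1) hij (Nat.le_succ j), stageHom_succ, Category.assoc, ih,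
      stage_succ_hom]

/-- `Γ(V_m)` as a `Γ(U)`-algebra through `V_m → U`. [folklore] -/
instance stageAlgebra (m : ℕ) : Algebra Γ(U.left, ⊤) Γ((stage φ U s m).obj.left, ⊤) :=
  ((stage φ U s m).hom.left.appTop).hom.toAlgebra

/-- Unfolding of `algebraMap Γ(U) Γ(V_m)` (by `rfl`). [folklore] -/
theorem algebraMap_stage (m : ℕ) :
    algebraMap Γ(U.left, ⊤) Γ((stage φ U s m).obj.left, ⊤) = (stage φ U s m).hom.left.appTop.hom :=
  rfl

/-- The `Γ(U)`-algebra maps `Γ(V_i) → Γ(V_j)`, `i ≤ j`, induced by `V_j → V_i`. [folklore] -/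
def stageAlgHom (i j : ℕ) (h : i ≤ j) :
    Γ((stage φ U s i).obj.left, ⊤) →ₐ[Γ(U.left, ⊤)] Γ((stage φ U s j).obj.left, ⊤) :=
  { (stageHom φ U s i j h).left.appTop.hom with
    commutes' := fun r => by
      change ((stage φ U s i).hom.left.appTop ≫ (stageHom φ U s i j h).left.appTop).hom r =
        (stage φ U s j).hom.left.appTop.hom r
      rw [← Scheme.Hom.comp_appTop]
      have e : (stageHom φ U s i j h).left ≫ (stage φ U s i).hom.left = (stage φ U s j).hom.left :=
        congrArg (fun q => q.left) (stageHom_comp_hom φ U s i j h)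
      rw [e] }

/-- On elements, `stageAlgHom` is pull-back of functions along `V_j → V_i`. [folklore] -/
@[simp] theorem stageAlgHom_apply (i j : ℕ) (h : i ≤ j) (x : Γ((stage φ U s i).obj.left, ⊤)) :
    stageAlgHom φ U s i j h x = (stageHom φ U s i j h).left.appTop.hom x := rfl

/-- The `Γ(V_m)` form a directed system of `Γ(U)`-algebras. [folklore] -/
instance directedSystem_stage :
    DirectedSystem (fun m => (Γ((stage φ U s m).obj.left, ⊤) : Type u))
      fun i j h => stageAlgHom φ U s i j h where
  map_self i x := by
    rw [stageAlgHom_apply, stageHom_self]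
    rfl
  map_map {c b a} hab hbc x := by
    rw [stageAlgHom_apply, stageAlgHom_apply, stageAlgHom_apply, stageHom_trans φ U s a b c hab hbc]
    rfl

/-- **The limit algebra `B = colim_m Γ(V_m)`** of the tower (Bhatt–Scholze Example 3.1.7:
"`B = colim_n B_n`"). [cite: BhattScholze2015, Example 3.1.7] -/
abbrev towerLimit : Type u :=
  DirectLimit (fun m => (Γ((stage φ U s m).obj.left, ⊤) : Type u)) (stageAlgHom φ U s)

/-- Each `Γ(V_m)` is weakly étale over `Γ(U)`. [folklore] -/
instance weaklyEtale_stage (m : ℕ) :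
    Algebra.WeaklyEtale Γ(U.left, ⊤) Γ((stage φ U s m).obj.left, ⊤) :=
  weaklyEtale_appTop (stage φ U s m).hom

/-- Each `Γ(V_m)` is faithfully flat over `Γ(U)`. [folklore] -/
instance faithfullyFlat_stage (m : ℕ) :
    Module.FaithfullyFlat Γ(U.left, ⊤) Γ((stage φ U s m).obj.left, ⊤) :=
  faithfullyFlat_appTop (stage φ U s m).hom

/-- **`B = colim Γ(V_m)` is weakly étale over `Γ(U)`** (Bhatt–Scholze Lemma 4.1.8).
[cite: BhattScholze2015, Lemma 4.1.8] -/
instance weaklyEtale_towerLimit : Algebra.WeaklyEtale Γ(U.left, ⊤) (towerLimit φ U s) :=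
  Literature.RingTheory.Etale.weaklyEtale_directLimit _

/-- **`B = colim Γ(V_m)` is faithfully flat over `Γ(U)`** (Bhatt–Scholze Example 3.1.7).
[cite: BhattScholze2015, Example 3.1.7] -/
instance faithfullyFlat_towerLimit : Module.FaithfullyFlat Γ(U.left, ⊤) (towerLimit φ U s) :=
  Literature.RingTheory.Etale.faithfullyFlat_directLimit _

/-- **The limit `W = Spec B` of the tower, as an object of `X_proét`** (`B = colim Γ(V_m)` is
weakly étale over `Γ(U)`, Bhatt–Scholze Lemma 4.1.8). [cite: BhattScholze2015, Lemma 4.1.8] -/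
def towerSpec : X.ProEt := proetSpec U (towerLimit φ U s)

/-- The structure map `W = Spec B ⟶ U`, a surjective map of affine objects of `X_proét`.
[folklore] -/
def towerSpecHom : towerSpec φ U s ⟶ U := proetSpecHom U (towerLimit φ U s)

/-- **`W = Spec B → U` is a pro-étale cover** (Bhatt–Scholze Example 3.1.7: "`Spec(B) → Spec(A)` is
an fpqc cover"). [cite: BhattScholze2015, Example 3.1.7] -/
theorem generate_singleton_towerSpecHom_mem :
    Sieve.generate (Presieve.singleton (towerSpecHom φ U s)) ∈ Scheme.ProEt.topology X U :=
  generate_singleton_proetSpecHom_mem U (towerLimit φ U s)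

/-- The maps `W = Spec B ⟶ V_m` of `X_proét`. [folklore] -/
def towerLimitπ (m : ℕ) : towerSpec φ U s ⟶ (stage φ U s m).obj :=
  proetSpecLift (stage φ U s m).hom
    (DirectLimit.Algebra.of _ (stageAlgHom φ U s) m).toRingHom
    (by rw [← algebraMap_stage]; exact (DirectLimit.Algebra.of _ (stageAlgHom φ U s) m).comp_algebraMap)

/-- `W ⟶ V_m ⟶ U` is the structure map `W ⟶ U`. [folklore] -/
@[simp] theorem towerLimitπ_comp_hom (m : ℕ) :
    towerLimitπ φ U s m ≫ (stage φ U s m).hom = towerSpecHom φ U s :=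
  proetSpecLift_comp _ _ _ _ _

/-- **Over `W = Spec B`, every `s_m` lifts to `F_m`.** [cite: BhattScholze2015, Example 3.1.7] -/
theorem exists_lift_towerSpec (m : ℕ) :
    ∃ t : (F m).obj.obj (op (towerSpec φ U s)),
      (φ m).hom.app _ t = (G m).obj.map (towerSpecHom φ U s).op (s m) := by
  obtain ⟨t, ht⟩ := exists_lift_stage_succ φ U s m
  refine ⟨(F m).obj.map (towerLimitπ φ U s (m + 1)).op t, ?_⟩
  have h₁ := ConcreteCategory.congr_hom ((φ m).hom.naturality (towerLimitπ φ U s (m + 1)).op) t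
  have h₂ := congrArg (fun k => (G m).obj.map (Quiver.Hom.op k) (s m))
    (towerLimitπ_comp_hom φ U s (m + 1))
  simp only [ConcreteCategory.comp_apply] at h₁
  simp only [op_comp, Functor.map_comp, ConcreteCategory.comp_apply] at h₂
  rw [h₁, ht]
  exact h₂

end Tower

/-! ### Countable products of epimorphisms -/

section Products

variable {F G : ℕ → Sheaf (Scheme.ProEt.topology X) Ab.{u + 1}} (φ : ∀ m, F m ⟶ G m)
  [∀ m, Epi (φ m)]

/-- Over an affine `U`, a section of `∏ G_m` lifts to `∏ F_m` over a pro-étale cover (the limit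
`W = Spec B → U` of the tower). [cite: BhattScholze2015, Example 3.1.7] -/
theorem imageSieve_piMap_mem (U : X.ProEt) [IsAffine U.left] (x : (∏ᶜ G).obj.obj (op U)) :
    Presheaf.imageSieve (Limits.Pi.map φ).hom x ∈ Scheme.ProEt.topology X U := by
  set s : ∀ m, (G m).obj.obj (op U) := fun m => (Pi.π G m).hom.app _ x with hs
  refine (Scheme.ProEt.topology X).superset_covering ?_
    (generate_singleton_towerSpecHom_mem φ U s)
  rw [Sieve.generate_le_iff]
  rintro Y f ⟨⟩
  choose t ht using fun m => exists_lift_towerSpec φ U s m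
  obtain ⟨T, hT⟩ := (piSheaf_sections_bijective F _).2 t
  refine ⟨T, (piSheaf_sections_bijective G _).1 (funext fun m => ?_)⟩
  have hTm : (Pi.π F m).hom.app _ T = t m := congr_fun hT m
  have h₁ := ConcreteCategory.congr_hom (congr_app (congrArg InducedCategory.Hom.hom
    (Limits.Pi.map_π φ m)) (op (towerSpec φ U s))) T
  have h₂ := ConcreteCategory.congr_hom ((Pi.π G m).hom.naturality (towerSpecHom φ U s).op) x
  simp only [ObjectProperty.FullSubcategory.comp_hom, NatTrans.comp_app,
    ConcreteCategory.comp_apply] at h₁ h₂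
  change (Pi.π G m).hom.app _ ((Limits.Pi.map φ).hom.app _ T) =
    (Pi.π G m).hom.app _ ((∏ᶜ G).obj.map (towerSpecHom φ U s).op x)
  rw [h₁, h₂, hTm, ht m]

/-- A section of `∏ G_m` over any `U ∈ X_proét` lifts to `∏ F_m` locally (reduce to the affine
opens of `U`, which form a pro-étale cover). [folklore] -/
theorem imageSieve_piMap_mem' (U : X.ProEt) (x : (∏ᶜ G).obj.obj (op U)) :
    Presheaf.imageSieve (Limits.Pi.map φ).hom x ∈ Scheme.ProEt.topology X U := by
  refine (Scheme.ProEt.topology X).transitive (ofArrows_affineOpens_mem_proEtTopology U) _ ?_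
  rintro V g ⟨Y, h, f, ⟨O⟩, rfl⟩
  rw [Presheaf.pullback_imageSieve, op_comp, Functor.map_comp, ConcreteCategory.comp_apply,
    ← Presheaf.pullback_imageSieve]
  exact (Scheme.ProEt.topology X).pullback_stable _ (imageSieve_piMap_mem φ _ _)

/-- **Countable products of epimorphisms of abelian sheaves on `X_proét` are epimorphisms**
("countable products are exact" in `Shv(X_proét)`, Bhatt–Scholze Prop. 3.1.9 with Prop. 4.2.8;
proved here by the tower argument of Example 3.1.7 on Mathlib's site `X.ProEt`, which has no
cardinality bound: reduce to affine `U` by the Zariski cover by affine opens, build the tower of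
affine surjective weakly étale covers `U ← V₁ ← V₂ ← ⋯` over which the components lift one at a
time, and pass to the limit `Spec (colim Γ(V_m)) → U`, again a cover by Lemma 4.1.8).
[cite: BhattScholze2015, Prop. 3.1.9 and Example 3.1.7] -/
theorem epi_piMap_of_epi : Epi (Limits.Pi.map φ) :=
  (Sheaf.isLocallySurjective_iff_epi' Ab.{u + 1} (Limits.Pi.map φ)).1
    ⟨fun {U} x => imageSieve_piMap_mem' φ U x⟩

end Products

end Literature.AlgebraicGeometry.Motives

end
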